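import Mathlib
import Summits.Ventures.PercRepro2.SkeletonClasses
import Summits.Ventures.PercRepro2.PocketSign

/-!
# The root-only pocket modulo reduction (blind cell PercRepro2, night-1 g17; NIGHT1-G17.md §3)

`PocketConn.HMF_pocket` asks every edge leaving the pocket `P ∋ a₃` to end at a root, including
the zero-weight edges.  Modulo re-routing (one `Step.reroute` puts every zero-weight edge on a loop
at `a₁ ∉ P`) only the NONZERO edges matter:

* **`HMF_of_nz_pocket`** / **`HCov_of_nz_pocket`**: every nonzero edge with an end in `P` has its
  other end in `P` or at a root; `a₁, a₂, o, b ∉ P`, `a₃ ∈ P`, `a₁ ≠ a₂` ⊢ (HMF);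
* **`HMF_of_reduces_nz_pocket`** / **`HCov_of_reduces_nz_pocket`**: the same for any reduct
  (`Skeleton.Reduces`) of the instance — the class P of the coverage map of NIGHT1-G17.md §3,
  stated on the nonzero edges of the reduct like the classes M and H of SkeletonClasses.lean.

Own code; standard axioms.
-/

open scoped Classical

namespace Summit.Ventures.PercRepro2

open UnionCluster CovForm

namespace Skeleton

section Pocket

variable {V : Type*} {E : Type*} [Fintype E] [DecidableEq E] [Fintype V] [DecidableEq V]
  {R : Type*} [Field R] [LinearOrder R] [IsStrictOrderedRing R]

variable {o a₁ a₂ a₃ b : V}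

omit [Fintype E] [DecidableEq E] [Fintype V] [DecidableEq V] [IsStrictOrderedRing R] in
/-- After re-routing the zero-weight edges to loops at `a₁ ∉ P`, a nonzero-edge pocket is a
pocket. -/
lemma isPocket_reroute (q : E → R) (ends' : E → Sym2 V) {P : Finset V} (h1 : a₁ ∉ P)
    (hP : ∀ e, q e ≠ 0 → ∀ x y, ends' e = s(x, y) → x ∈ P → y ∈ P ∨ y = a₁ ∨ y = a₂) :
    PocketConn.IsPocket (reroute q ends' a₁) (↑P : Set V) a₁ a₂ := by
  intro e x y hexy hx
  by_cases hq : q e = 0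
  · simp only [reroute, hq, if_true] at hexy
    rcases Sym2.eq_iff.1 hexy with ⟨hx1, -⟩ | ⟨-, hx1⟩ <;>
    · subst hx1
      exact absurd (Finset.mem_coe.1 hx) h1
  · rw [reroute_of_ne q ends' a₁ hq] at hexy
    exact hP e hq x y hexy hx

/-- **The root-only pocket on the nonzero edges** (HMF). -/
theorem HMF_of_nz_pocket (p : E → R) (ends : E → Sym2 V) (hp : IsProbVec p) {P : Finset V}
    (hP : ∀ e, p e ≠ 0 → ∀ x y, ends e = s(x, y) → x ∈ P → y ∈ P ∨ y = a₁ ∨ y = a₂)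
    (h12 : a₁ ≠ a₂) (h1 : a₁ ∉ P) (h2 : a₂ ∉ P) (ho : o ∉ P) (hb : b ∉ P) (h3 : a₃ ∈ P) :
    HMF p ends o a₁ a₂ a₃ b := by
  have hstep : Reduces o a₁ a₂ a₃ b (p, ends) (p, reroute p ends a₁) :=
    Relation.ReflTransGen.single (step_reroute p ends)
  refine HMF_of_reduces (I := (p, ends)) hstep hp ?_
  exact PocketConn.HMF_pocket p hp (isPocket_reroute p ends h1 hP) h12 h1 h2 ho hb h3

/-- **The root-only pocket on the nonzero edges** (HCOV). -/
theorem HCov_of_nz_pocket (p : E → R) (ends : E → Sym2 V) (hp : IsProbVec p) {P : Finset V}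
    (hP : ∀ e, p e ≠ 0 → ∀ x y, ends e = s(x, y) → x ∈ P → y ∈ P ∨ y = a₁ ∨ y = a₂)
    (h12 : a₁ ≠ a₂) (h1 : a₁ ∉ P) (h2 : a₂ ∉ P) (ho : o ∉ P) (hb : b ∉ P) (h3 : a₃ ∈ P) :
    HCov p ends o a₁ a₂ a₃ b :=
  HCov_of_HMF p hp ends o a₁ a₂ a₃ b (HMF_of_nz_pocket p ends hp hP h12 h1 h2 ho hb h3)

/-- **The root-only pocket modulo reduction** (HMF): if the instance reduces to one whose nonzero
edges leave a pocket `P ∋ a₃` only at the roots, (HMF) holds. -/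
theorem HMF_of_reduces_nz_pocket {p : E → R} {ends : E → Sym2 V} (hp : IsProbVec p)
    {q : E → R} {ends' : E → Sym2 V} (h : Reduces o a₁ a₂ a₃ b (p, ends) (q, ends')) {P : Finset V}
    (hP : ∀ e, q e ≠ 0 → ∀ x y, ends' e = s(x, y) → x ∈ P → y ∈ P ∨ y = a₁ ∨ y = a₂)
    (h12 : a₁ ≠ a₂) (h1 : a₁ ∉ P) (h2 : a₂ ∉ P) (ho : o ∉ P) (hb : b ∉ P) (h3 : a₃ ∈ P) :
    HMF p ends o a₁ a₂ a₃ b :=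
  HMF_of_reduces (I := (p, ends)) h hp
    (HMF_of_nz_pocket q ends' (isProbVec_of_reduces (I := (p, ends)) h hp) hP h12 h1 h2 ho hb h3)

/-- **The root-only pocket modulo reduction** (HCOV). -/
theorem HCov_of_reduces_nz_pocket {p : E → R} {ends : E → Sym2 V} (hp : IsProbVec p)
    {q : E → R} {ends' : E → Sym2 V} (h : Reduces o a₁ a₂ a₃ b (p, ends) (q, ends')) {P : Finset V}
    (hP : ∀ e, q e ≠ 0 → ∀ x y, ends' e = s(x, y) → x ∈ P → y ∈ P ∨ y = a₁ ∨ y = a₂)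
    (h12 : a₁ ≠ a₂) (h1 : a₁ ∉ P) (h2 : a₂ ∉ P) (ho : o ∉ P) (hb : b ∉ P) (h3 : a₃ ∈ P) :
    HCov p ends o a₁ a₂ a₃ b :=
  HCov_of_HMF p hp ends o a₁ a₂ a₃ b
    (HMF_of_reduces_nz_pocket hp h hP h12 h1 h2 ho hb h3)

end Pocket

end Skeleton

end Summit.Ventures.PercRepro2
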